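import Summits.KontsevichZagierPeriods.Zeta5Search.Certificates.RayC1KernelPeriodicTable
import Summits.KontsevichZagierPeriods.Zeta5Search.RVPeriodicWindows
import HarnessLib

/-!
# ζ(5) search — certificates: the CLASS kind of periodic tables — fam-rv's periodic window theorems consumed at every shift (CERT-1 g6)

HONEST FRAMING: systematic search; no irrationality claim unless certified.  `p`-adic bookkeeping of explicit rationals; nothing
here is a statement about `ζ(5)`; every exponent this feeds is `< 1` (calibration ladder of the T1-map ray C1; λ* = 108.2193 is the
certified tie; no crossing claimed).

OUR work (Summit side; cert-1 seat, generation 6; consumer side of the lead's (S2), agreed with typer g17 INBOX 2026-08-21T23:33Z).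
Sequel of `RayC1KernelPeriodicTable` (periodic entries, `PSound`, brick kind).  fam-rv g17's `RVPeriodicWindows.PWin` is ONE class-law
window theorem per `ω`-cell `[u₁/u₂, v₁/v₂)` for EVERY shift `m ≥ 1`, with Casoratian floor `B₁ − 256·m`.  Along the cell the kernel
exponent `k = 9 + 2·v_p(N♯) + B` is `m`-FREE: `⌊c·n/p⌋ ∈ [c·m + ⌊c·u⌋, c·m + ⌈c·v⌉ − 1]` (`pL_le`, `le_pU`), so
`v_p(N♯(b)) = v_p(N♯(b′)) ≥ 128·m + vNlo0(u,v)` (blocks `28,30,33,36,33,30 − 32,30`) and `v_p(ρ(a·n)) ≤ 256·m + vRhi0(u,v)` (`449 − 193`),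
against `B₁ − 256·m`: both conditions of `RayKernel.cell_cert` lose their `m`.  Hence:
* `pClassCond pw NT e` — entry `(u, v, w, 8·j + 4)`: `[u, v)` inside the cell of `pw[j]`, `N0 ≤ NT`, `w ≤ 9 + 2·vNlo0 + B₁`,
  `w ≤ 9 + 2·vNlo0 − vRhi0` (decidable);
* **`psound_class : (∀ c ∈ pw, c.Holds) → PSound (pClassCond pw NT) NT`** (`NT ≥ 1`) — to be `||`-combined with `pBrickCond`
  (`psound_or`) and consumed by `RayC1KernelPeriodic.c1_exponent_of_tables`.
-/

noncomputable section

open Finset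

namespace Summit.KontsevichZagierPeriods.Zeta5Search.RayC1

open Summit.KontsevichZagierPeriods.Zeta5Search.DualSeries
open Summit.KontsevichZagierPeriods.Zeta5Search.DualSeriesDenominators
open Summit.KontsevichZagierPeriods.Zeta5Search.WedgeDictionary
open Summit.KontsevichZagierPeriods.Zeta5Search.RayKernel
open Summit.KontsevichZagierPeriods.Zeta5Search.Denom.DigitCert
open Summit.KontsevichZagierPeriods.Zeta5Search.CasoratianValuation (casoratian shift)
open Summit.KontsevichZagierPeriods.Zeta5Search.RVPeriodic (PWin)
open Literature.NumberTheory.Irrationality.Hata1992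

/-- Default periodic class cell for out-of-range indices. -/
def pwinDefault : PWin := ⟨0, 1, 0, 1, 0, 0⟩

/-- **Class branch** for a periodic entry `(u, v, w, 8·j + 4)` (decidable): `[u, v)` inside the cell of `pw[j]` (`u₁/u₂ ≤ u`, `v ≤ v₁/v₂ ≤ 1`,
`0 < u₂, v₂`), `0 < u < v`, `N0 ≤ NT`, and the two `m`-free exponent conditions `w ≤ 9 + 2·vNlo0 + B₁`, `w ≤ 9 + 2·vNlo0 − vRhi0`. -/
def pClassCond (pw : List PWin) (NT : ℕ) (e : WinEntry) : Bool :=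
  decide (e.2.2.2 % 8 = 4) && decide (e.2.2.2 / 8 < pw.length) &&
  (let c := pw.getD (e.2.2.2 / 8) pwinDefault
   decide (0 < c.u2) && decide (0 < c.v2) && decide (c.v1 ≤ c.v2) &&
   decide ((c.u1 : ℚ) / (c.u2 : ℚ) ≤ e.1) && decide (e.2.1 ≤ (c.v1 : ℚ) / (c.v2 : ℚ)) && decide (0 < e.1) && decide (e.1 < e.2.1) &&
   decide (c.N0 ≤ NT) &&
   decide ((e.2.2.1 : ℤ) ≤ 9 + 2 * vNlo0 e.1 e.2.1 + c.B1) && decide ((e.2.2.1 : ℤ) ≤ 9 + 2 * vNlo0 e.1 e.2.1 - vRhi0 e.1 e.2.1))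

/-! ### Soundness of the class branch -/

/-- Unpacking the class branch. -/
theorem pClassCond_sound {pw : List PWin} {NT : ℕ} {e : WinEntry} (h : pClassCond pw NT e = true) :
    ∃ c ∈ pw, 0 < c.u2 ∧ 0 < c.v2 ∧ c.v1 ≤ c.v2 ∧ (c.u1 : ℚ) / (c.u2 : ℚ) ≤ e.1 ∧ e.2.1 ≤ (c.v1 : ℚ) / (c.v2 : ℚ) ∧ 0 < e.1 ∧
      e.1 < e.2.1 ∧ c.N0 ≤ NT ∧ (e.2.2.1 : ℤ) ≤ 9 + 2 * vNlo0 e.1 e.2.1 + c.B1 ∧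
      (e.2.2.1 : ℤ) ≤ 9 + 2 * vNlo0 e.1 e.2.1 - vRhi0 e.1 e.2.1 := by
  simp only [pClassCond, Bool.and_eq_true, decide_eq_true_eq, and_assoc] at h
  obtain ⟨-, hlen, h1, h2, h3, h4, h5, h6, h7, h8, h9, h10⟩ := h
  refine ⟨pw.getD (e.2.2.2 / 8) pwinDefault, ?_, h1, h2, h3, h4, h5, h6, h7, h8, h9, h10⟩
  rw [List.getD_eq_getElem _ _ hlen]
  exact List.getElem_mem hlen

/-- **`pClassCond pw NT` is sound from `NT ≥ 1`** under `∀ c ∈ pw, c.Holds`: fam-rv's periodic window theorem at the shift `m`, the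
single-digit valuation laws of `d`, `N♯(b)`, `N♯(b′)` (`p ∤ n` variant), `ρ(a·n)`, the `m`-free parts `vNlo0`/`vRhi0`, and `cell_cert`. -/
theorem psound_class {pw : List PWin} (hpw : ∀ c ∈ pw, c.Holds) {NT : ℕ} (hNT : 1 ≤ NT) : PSound (pClassCond pw NT) NT := by
  intro e he
  obtain ⟨c, hc, hu2, hv2, hv12, hu, hv, he1, hlt, hN0, hk1, hk2⟩ := pClassCond_sound he
  have hv2q : (0 : ℚ) < c.v2 := by exact_mod_cast hv2
  have hu2q : (0 : ℚ) < c.u2 := by exact_mod_cast hu2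
  have hV1 : (c.v1 : ℚ) / (c.v2 : ℚ) ≤ 1 := by rw [div_le_one hv2q]; exact_mod_cast hv12
  have he3 : e.2.1 ≤ 1 := le_trans hv hV1
  refine ⟨⟨he1, hlt, he3⟩, fun n hn m hm1 hm p hp => ?_⟩
  obtain ⟨hpr, hnd, hp85, hpn, hsq, hlo, hhi⟩ := periodic_prime_facts he1 hlt he3 (le_trans hNT hn) hm1 hm hp
  haveI := Fact.mk hpr
  have hp33 : 33 < p := by omega
  have hn1 : 1 ≤ n := le_trans hNT hn
  have hp0 : 0 < p := hpr.pos
  have hpB : p ≤ 85 * n := by omega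
  have hsq85 : 85 * n < p ^ 2 := by omega
  have hsq852 : 85 * n + 2 < p * p := by nlinarith
  have hsq36 : 36 * n < p ^ 2 := by omega
  have hsq64 : 64 * n < p ^ 2 := by omega
  have hp2 : p ≠ 2 := by omega
  -- the periodic window theorem at shift `m`
  have hw1 : (m * c.u2 + c.u1) * p ≤ c.u2 * n := by
    have h1 : ((m : ℚ) + (c.u1 : ℚ) / c.u2) * p ≤ ((m : ℚ) + e.1) * p :=
      mul_le_mul_of_nonneg_right (by linarith) (Nat.cast_nonneg p)
    have h2 := mul_le_mul_of_nonneg_right (h1.trans hlo) hu2q.le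
    have h3 : ((m : ℚ) + (c.u1 : ℚ) / c.u2) * p * c.u2 = (((m * c.u2 + c.u1) * p : ℕ) : ℚ) := by
      push_cast; field_simp
    rw [h3] at h2
    have h4 : (m * c.u2 + c.u1) * p ≤ n * c.u2 := by exact_mod_cast h2
    rw [Nat.mul_comm c.u2 n]; exact h4
  have hw2 : c.v2 * n < (m * c.v2 + c.v1) * p := by
    have h1 : ((m : ℚ) + e.2.1) * p ≤ ((m : ℚ) + (c.v1 : ℚ) / c.v2) * p :=
      mul_le_mul_of_nonneg_right (by linarith) (Nat.cast_nonneg p)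
    have h2 := mul_lt_mul_of_pos_right (lt_of_lt_of_le hhi h1) hv2q
    have h3 : ((m : ℚ) + (c.v1 : ℚ) / c.v2) * p * c.v2 = (((m * c.v2 + c.v1) * p : ℕ) : ℚ) := by
      push_cast; field_simp
    rw [h3] at h2
    have h4 : n * c.v2 < (m * c.v2 + c.v1) * p := by exact_mod_cast h2
    rw [Nat.mul_comm c.v2 n]; exact h4
  have hcas := hpw c hc n p m (le_trans hN0 hn) hpr hm1 hsq852 hw1 hw2
  rw [casoratian, bC1_shift] at hcas
  -- the valuation laws (single-digit range)
  have hd : padicValRat p (dOf0 (bC1 n)) = 1 := by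
    apply padicValRat_dOf0_eq_one
    · rw [bn_bC1_zero]; exact hpB
    · rw [bn_bC1_zero]
      have h' : ((85 * n : ℕ) : ℤ) < ((p ^ 2 : ℕ) : ℤ) := by exact_mod_cast hsq85
      exact_mod_cast h'
  have hvN := padicValRat_sharpNormaliser_bC1 (n := n) hpr hsq36
  have hvN' := padicValRat_sharpNormaliser_bC1'_nd hn1 hpr hnd hp33 hsq36
  have hvr := padicValRat_rhoOf_aC1 (n := n) hpr hp2 hsq64
  have hq := qminor_floor_of_int (p := p) (rhoOf_aC1_ne_zero n) (c1Q_eq_wedge hn1)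
  rw [hvr] at hq
  -- integer parts along the cell
  have l28 := pL_le (c := 28) hp0 hlo
  have l30 := pL_le (c := 30) hp0 hlo
  have l33 := pL_le (c := 33) hp0 hlo
  have l36 := pL_le (c := 36) hp0 hlo
  have u32 := le_pU (c := 32) (by norm_num) hp0 hhi
  have u30 := le_pU (c := 30) (by norm_num) hp0 hhi
  have u18 := le_pU (c := 18) (by norm_num) hp0 hhi
  have u20 := le_pU (c := 20) (by norm_num) hp0 hhi
  have u23 := le_pU (c := 23) (by norm_num) hp0 hhi
  have u25 := le_pU (c := 25) (by norm_num) hp0 hhi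
  have u26 := le_pU (c := 26) (by norm_num) hp0 hhi
  have u28 := le_pU (c := 28) (by norm_num) hp0 hhi
  have u31 := le_pU (c := 31) (by norm_num) hp0 hhi
  have u33 := le_pU (c := 33) (by norm_num) hp0 hhi
  have u35 := le_pU (c := 35) (by norm_num) hp0 hhi
  have u38 := le_pU (c := 38) (by norm_num) hp0 hhi
  have u40 := le_pU (c := 40) (by norm_num) hp0 hhi
  have u43 := le_pU (c := 43) (by norm_num) hp0 hhi
  have l35 := pL_le (c := 35) hp0 hlo
  have l27 := pL_le (c := 27) hp0 hlo
  have l25 := pL_le (c := 25) hp0 hlo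
  have l22 := pL_le (c := 22) hp0 hlo
  have l20 := pL_le (c := 20) hp0 hlo
  have l64 := pL_le (c := 64) hp0 hlo
  simp only [vNlo0, vRhi0] at hk1 hk2
  refine cell_cert (sharpAdmissible_bC1 hn1) (sharpAdmissible_bC1' hn1) (bn0_bC1' n) hd hvN hvN' hcas hq ?_ ?_
  · push_cast at *; linarith
  · push_cast at *; linarith

end Summit.KontsevichZagierPeriods.Zeta5Search.RayC1
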